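import Mathlib.Analysis.InnerProductSpace.Laplacian
import Literature.Analysis.Calculus.EvolutionDerivBounds
import Literature.Analysis.FluidPDE.OseenSliceHolder
import HarnessLib

/-!
# Crux `MixingPayoff` (stmt-NavierStokesRegularity-1422), line `birth`, stub W2
  (`stub_advectionDiffusionSchwartz`): uniform bounds on ALL space–time derivatives of a
  solution of `∂ₜψ = Δψ + ⟪β, ∇ψ⟫ + γψ` from uniform bounds on its spatial derivatives

Helper file (lands `--supports stmt-NavierStokesRegularity-1422`). The tree's anisotropic
bookkeeping `Literature.Analysis.Calculus.AnisoBdd` (`EvolutionDerivBounds.lean`: "`∂ₜˡ u` has all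
spatial derivatives bounded for `l ≤ n`", closed under sums, continuous (bi)linear maps and `∂_y`,
and bounding all joint derivatives `Dᵏu`, `k ≤ n`) is run along the LINEAR equation on the
whole space: its general evolution lemma `anisoBdd_of_evolution` asks for a domain bounded in
space (the nonlinearity may depend on `y`), whereas for a linear equation with `C_b^∞`
coefficients the closure lemmas suffice on `E × (a, b)`:

* `anisoBdd_of_cb` — a coefficient field `(y, t) ↦ F(t, y)` with `F ∈ C_b^∞(ℝ × E)` is
  `AnisoBdd` of every order (its time derivative is again such a field);
* `uniform_joint_bounds` — for `ψ` jointly `C^∞` on `[a, b) × E`, solving the equation on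
  `(a, b)` and with all slices bounded in every `Cⁿ` uniformly, every joint derivative
  `Dⁿ(uncurry ψ)` is bounded on `(a, b) × E`;
* `uniform_within_bounds` — hence the derivatives WITHIN the closed slab `[a, b'] × E`,
  `b' < b`, are bounded (interior points: `iteratedFDerivWithin = iteratedFDeriv`; the initial
  face by continuity of the within-derivatives).
-/

noncomputable section

open Set Function Filter Metric Real
open _root_.Topology
open scoped ContDiff Laplacian InnerProductSpace

-- `Summit = Problem` for this summit; the tree lakefile sets `weak.linter.dupNamespace = false`.
set_option linter.dupNamespace false

namespace Summit.NavierStokesRegularity.NavierStokesRegularity.Theorems.SelfMixingDichotomy.MixingPayoffBirth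

open Literature.Analysis.Calculus Literature.Analysis.FluidPDE

-- nested operator types
set_option maxSynthPendingDepth 3

section Coefficients

variable {E : Type} [NormedAddCommGroup E] [NormedSpace ℝ E]
variable {W : Type} [NormedAddCommGroup W] [NormedSpace ℝ W]

/-- Spatial slices of a `C_b^∞` space–time field have uniformly bounded derivatives: the field
`(y, t) ↦ F(t, y)` is `SpatiallyBdd` on any set. -/
theorem spatiallyBdd_of_cb {F : ℝ × E → W} (hF : ContDiff ℝ ∞ F)
    (hFb : ∀ m, ∃ C, ∀ p, ‖iteratedFDeriv ℝ m F p‖ ≤ C) (Ω : Set (E × ℝ)) :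
    SpatiallyBdd Ω (fun q : E × ℝ => F (q.2, q.1)) := by
  refine ⟨(hF.comp (contDiff_snd.prodMk contDiff_fst)).contDiffOn, fun m => ?_⟩
  obtain ⟨C, hC⟩ := hFb m
  have hC0 : 0 ≤ C := (norm_nonneg _).trans (hC 0)
  refine ⟨C * ‖ContinuousLinearMap.inr ℝ ℝ E‖ ^ m, fun q _ => ?_⟩
  have hfun : (fun y : E => F (q.2, y)) =
      (fun z : ℝ × E => F (((q.2, (0 : E)) : ℝ × E) + z)) ∘ (ContinuousLinearMap.inr ℝ ℝ E) := by
    funext y; simp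
  have hsh : ContDiff ℝ ∞ fun z : ℝ × E => F (((q.2, (0 : E)) : ℝ × E) + z) :=
    hF.comp (contDiff_const.add contDiff_id)
  change ‖iteratedFDeriv ℝ m (fun y : E => F (q.2, y)) q.1‖ ≤ _
  rw [hfun, (ContinuousLinearMap.inr ℝ ℝ E).iteratedFDeriv_comp_right hsh q.1 (mod_cast le_top),
    iteratedFDeriv_comp_add_left]
  refine (ContinuousMultilinearMap.norm_compContinuousLinearMap_le _ _).trans ?_
  rw [Finset.prod_const, Finset.card_univ, Fintype.card_fin]
  exact mul_le_mul_of_nonneg_right (hC _) (by positivity)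

/-- The time derivative of the field `(y, t) ↦ F(t, y)` is the field of `∂₁F = DF(·)(1, 0)`. -/
theorem dT_of_cb {F : ℝ × E → W} (hF : ContDiff ℝ ∞ F) (q : E × ℝ) :
    dT (fun q : E × ℝ => F (q.2, q.1)) q = fderiv ℝ F (q.2, q.1) ((1 : ℝ), (0 : E)) := by
  unfold dT
  have h1 : HasDerivAt (fun s : ℝ => ((s, q.1) : ℝ × E)) ((1 : ℝ), (0 : E)) q.2 := by
    have h := (hasFDerivAt_prodMk_left (𝕜 := ℝ) q.2 q.1).hasDerivAt
    simpa using h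
  exact (((hF.differentiable (by simp)) _).hasFDerivAt.comp_hasDerivAt q.2 h1).deriv

/-- A directional derivative of a `C_b^∞` field is a `C_b^∞` field. -/
theorem cb_fderiv_apply {F : ℝ × E → W} (hF : ContDiff ℝ ∞ F)
    (hFb : ∀ m, ∃ C, ∀ p, ‖iteratedFDeriv ℝ m F p‖ ≤ C) (v : ℝ × E) :
    ContDiff ℝ ∞ (fun p => fderiv ℝ F p v) ∧
      ∀ m, ∃ C, ∀ p, ‖iteratedFDeriv ℝ m (fun p => fderiv ℝ F p v) p‖ ≤ C := by
  have hfd : ContDiff ℝ ∞ (fderiv ℝ F) := hF.fderiv_right (mod_cast le_top)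
  refine ⟨hfd.clm_apply contDiff_const, fun m => ?_⟩
  obtain ⟨C, hC⟩ := hFb (m + 1)
  refine ⟨‖ContinuousLinearMap.apply ℝ W v‖ * C, fun p => ?_⟩
  rw [show (fun p => fderiv ℝ F p v) = (ContinuousLinearMap.apply ℝ W v) ∘ (fderiv ℝ F) from rfl]
  refine ((ContinuousLinearMap.apply ℝ W v).norm_iteratedFDeriv_comp_left hfd.contDiffAt
    (n := m) (mod_cast le_top)).trans ?_
  rw [norm_iteratedFDeriv_fderiv]
  exact mul_le_mul_of_nonneg_left (hC p) (norm_nonneg _)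

/-- **A `C_b^∞` coefficient field is `AnisoBdd` of every order** (induction: its time
derivative is the `C_b^∞` field `∂₁F`). -/
theorem anisoBdd_of_cb {Ω : Set (E × ℝ)} (hΩ : IsOpen Ω) (n : ℕ) :
    ∀ {F : ℝ × E → W}, ContDiff ℝ ∞ F → (∀ m, ∃ C, ∀ p, ‖iteratedFDeriv ℝ m F p‖ ≤ C) →
      AnisoBdd Ω n (fun q : E × ℝ => F (q.2, q.1)) := by
  induction n with
  | zero => intro F hF hFb; exact anisoBdd_zero.2 (spatiallyBdd_of_cb hF hFb Ω)
  | succ n ih =>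
    intro F hF hFb
    obtain ⟨hF₁, hF₁b⟩ := cb_fderiv_apply hF hFb ((1 : ℝ), (0 : E))
    refine anisoBdd_succ.2 ⟨spatiallyBdd_of_cb hF hFb Ω, ?_⟩
    exact (ih hF₁ hF₁b).congr hΩ fun q _ => (dT_of_cb hF q).symm

end Coefficients

section Solution

variable {E : Type} [NormedAddCommGroup E] [InnerProductSpace ℝ E] [FiniteDimensional ℝ E]

/-- The Laplacian through the second derivative: `Δf(x) = Σᵢ D(Df)(x)(eᵢ)(eᵢ)`. -/
theorem laplacian_eq_sum_fderiv_fderiv (f : E → ℝ) (x : E) :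
    (Δ f) x = ∑ i, fderiv ℝ (fderiv ℝ f) x (stdOrthonormalBasis ℝ E i)
      (stdOrthonormalBasis ℝ E i) := by
  rw [congrFun (InnerProductSpace.laplacian_eq_iteratedFDeriv_orthonormalBasis f
    (stdOrthonormalBasis ℝ E)) x]
  refine Finset.sum_congr rfl fun i _ => ?_
  rw [iteratedFDeriv_two_apply]
  rfl

set_option maxHeartbeats 800000 in
/-- **Uniform bounds on all joint derivatives of a solution with uniformly bounded spatial
derivatives.** Let `β`, `γ` be `C_b^∞` on `ℝ × E`, and `ψ` jointly `C^∞` on `[a, b) × E`,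
solving `∂ₜψ = Δψ + Dψ[β] + γψ` on `(a, b)`, with all slices bounded in every `Cⁿ` uniformly on
`[a, b)`. Then every `Dⁿ(uncurry ψ)` is bounded on `(a, b) × E` (the `AnisoBdd` induction along
the linear equation, then `AnisoBdd.norm_iteratedFDeriv_le` and the swap `ℝ × E ≃ E × ℝ`). -/
theorem uniform_joint_bounds {β : ℝ → E → E} {γ : ℝ → E → ℝ}
    (hβ : ContDiff ℝ ∞ (uncurry β)) (hγ : ContDiff ℝ ∞ (uncurry γ))
    (hβb : ∀ n, ∃ C, ∀ p, ‖iteratedFDeriv ℝ n (uncurry β) p‖ ≤ C)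
    (hγb : ∀ n, ∃ C, ∀ p, ‖iteratedFDeriv ℝ n (uncurry γ) p‖ ≤ C)
    {ψ : ℝ → E → ℝ} {a b : ℝ} (hψs : ContDiffOn ℝ ∞ (uncurry ψ) (Ico a b ×ˢ univ))
    (hψeq : ∀ t ∈ Ioo a b, ∀ x, HasDerivAt (fun s => ψ s x)
      ((Δ (ψ t)) x + fderiv ℝ (ψ t) x (β t x) + γ t x * ψ t x) t)
    (hψsl : ∀ n, ∃ A, ∀ t ∈ Ico a b, IsCkBounded n A (ψ t)) (n : ℕ) :
    ∃ C, ∀ p ∈ Ioo a b ×ˢ (univ : Set E), ‖iteratedFDeriv ℝ n (uncurry ψ) p‖ ≤ C := by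
  classical
  -- the set-up in the order `(y, t)`
  set Ω : Set (E × ℝ) := {q | q.2 ∈ Ioo a b} with hΩ
  have hΩo : IsOpen Ω := isOpen_Ioo.preimage continuous_snd
  set u : E × ℝ → ℝ := fun q => ψ q.2 q.1 with hu
  have hus : ContDiffOn ℝ ∞ u Ω := by
    have h := hψs.comp (contDiff_snd.prodMk contDiff_fst).contDiffOn
      (fun q (hq : q ∈ Ω) => (⟨⟨hq.1.le, hq.2⟩, mem_univ _⟩ : (q.2, q.1) ∈ Ico a b ×ˢ univ))
    exact h.congr fun q _ => rfl
  have hu0 : SpatiallyBdd Ω u := by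
    refine ⟨hus, fun m => ?_⟩
    obtain ⟨A, hA⟩ := hψsl m
    exact ⟨A, fun q hq => (hA q.2 ⟨hq.1.le, hq.2⟩).norm_le m le_rfl q.1⟩
  -- the coefficient fields
  have hb : ∀ n, AnisoBdd Ω n (fun q : E × ℝ => β q.2 q.1) := fun n =>
    anisoBdd_of_cb hΩo n (F := uncurry β) hβ hβb
  have hg : ∀ n, AnisoBdd Ω n (fun q : E × ℝ => γ q.2 q.1) := fun n =>
    anisoBdd_of_cb hΩo n (F := uncurry γ) hγ hγb
  -- the trace and the two bilinear maps
  set e := stdOrthonormalBasis ℝ E with he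
  set Ltr : (E →L[ℝ] E →L[ℝ] ℝ) →L[ℝ] ℝ :=
    ∑ i, (ContinuousLinearMap.apply ℝ ℝ (e i)).comp (ContinuousLinearMap.apply ℝ (E →L[ℝ] ℝ) (e i))
    with hLtr
  have hLtr_apply : ∀ A : E →L[ℝ] E →L[ℝ] ℝ, Ltr A = ∑ i, A (e i) (e i) := fun A => by
    simp [hLtr]
  set Bev : (E →L[ℝ] ℝ) →L[ℝ] E →L[ℝ] ℝ := ContinuousLinearMap.id ℝ (E →L[ℝ] ℝ) with hBev
  set Bmul : ℝ →L[ℝ] ℝ →L[ℝ] ℝ := ContinuousLinearMap.mul ℝ ℝ with hBmul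
  -- ### the anisotropic induction along the equation
  have hA : ∀ n, AnisoBdd Ω n u := by
    intro n
    induction n with
    | zero => exact anisoBdd_zero.2 hu0
    | succ n ih =>
      refine anisoBdd_succ.2 ⟨hu0, ?_⟩
      have t1 : AnisoBdd Ω n (fun q => Ltr (dY (dY u) q)) :=
        ((ih.anisoBdd_dY hΩo).anisoBdd_dY hΩo).clm_comp hΩo Ltr
      have t2 : AnisoBdd Ω n (fun q => Bev (dY u q) (β q.2 q.1)) :=
        (ih.anisoBdd_dY hΩo).bilin hΩo Bev (hb n)
      have t3 : AnisoBdd Ω n (fun q => Bmul (γ q.2 q.1) (u q)) := (hg n).bilin hΩo Bmul ih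
      have hsum := (t1.add hΩo t2).add hΩo t3
      refine hsum.congr hΩo fun q hq => ?_
      -- the equation at `q = (y, t)`
      have hd : dT u q = (Δ (ψ q.2)) q.1 + fderiv ℝ (ψ q.2) q.1 (β q.2 q.1) +
          γ q.2 q.1 * ψ q.2 q.1 := (hψeq q.2 hq q.1).deriv
      simp only [Pi.add_apply]
      rw [hd, hLtr_apply, laplacian_eq_sum_fderiv_fderiv]
      simp only [hBev, hBmul, ContinuousLinearMap.id_apply, ContinuousLinearMap.mul_apply']
      rfl
  -- ### the joint bounds, transported to the order `(t, y)`
  obtain ⟨C, hC⟩ := (hA n).norm_iteratedFDeriv_le hΩo le_rfl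
  set S : (ℝ × E) ≃L[ℝ] (E × ℝ) := ContinuousLinearEquiv.prodComm ℝ ℝ E with hS
  refine ⟨C * ‖(S : (ℝ × E) →L[ℝ] (E × ℝ))‖ ^ n, fun p hp => ?_⟩
  have hpΩ : S p ∈ Ω := by simpa [hS, hΩ] using hp.1
  have hpre : S ⁻¹' Ω = Ioo a b ×ˢ (univ : Set E) := by
    ext q; simp [hS, hΩ, mem_prod]
  have hopen : IsOpen (Ioo a b ×ˢ (univ : Set E)) := isOpen_Ioo.prod isOpen_univ
  have hcomp : uncurry ψ = u ∘ S := by funext q; simp [hu, hS, uncurry]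
  have key := S.iteratedFDerivWithin_comp_right u hΩo.uniqueDiffOn hpΩ n
  rw [hpre, iteratedFDerivWithin_of_isOpen n hopen hp, iteratedFDerivWithin_of_isOpen n hΩo hpΩ]
    at key
  rw [hcomp, key]
  refine (ContinuousMultilinearMap.norm_compContinuousLinearMap_le _ _).trans ?_
  rw [Finset.prod_const, Finset.card_univ, Fintype.card_fin]
  exact mul_le_mul_of_nonneg_right (hC _ hpΩ) (by positivity)

omit [FiniteDimensional ℝ E] in
/-- **Bounds within the closed slab.** If `uncurry ψ` is `C^∞` on `[a, b) × E` and
`‖Dⁿ(uncurry ψ)‖ ≤ C` on `(a, b) × E`, then for `a < b' < b` the derivatives WITHIN the closed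
slab `[a, b'] × E` are bounded by `C` (they agree with the free derivatives for `t > a`, and are
continuous up to `t = a`). -/
theorem uniform_within_bounds {ψ : ℝ → E → ℝ} {a b b' : ℝ} (hab : a < b') (hbb : b' < b)
    (hψs : ContDiffOn ℝ ∞ (uncurry ψ) (Ico a b ×ˢ univ)) {n : ℕ} {C : ℝ}
    (hC : ∀ p ∈ Ioo a b ×ˢ (univ : Set E), ‖iteratedFDeriv ℝ n (uncurry ψ) p‖ ≤ C) :
    ∀ p ∈ Icc a b' ×ˢ (univ : Set E),
      ‖iteratedFDerivWithin ℝ n (uncurry ψ) (Icc a b' ×ˢ univ) p‖ ≤ C := by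
  set S : Set (ℝ × E) := Icc a b' ×ˢ univ with hSdef
  have hSU : UniqueDiffOn ℝ S := (uniqueDiffOn_Icc hab).prod uniqueDiffOn_univ
  have hsub : S ⊆ Ico a b ×ˢ univ := prod_mono (Icc_subset_Ico_right hbb) Subset.rfl
  have hψS : ContDiffOn ℝ ∞ (uncurry ψ) S := hψs.mono hsub
  have hcont : ContinuousOn (iteratedFDerivWithin ℝ n (uncurry ψ) S) S :=
    hψS.continuousOn_iteratedFDerivWithin (mod_cast le_top) hSU
  -- interior times
  have hint : ∀ p ∈ S, a < p.1 → ‖iteratedFDerivWithin ℝ n (uncurry ψ) S p‖ ≤ C := by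
    intro p hp hpa
    have hpo : p ∈ Ioo a b ×ˢ (univ : Set E) := ⟨⟨hpa, hp.1.2.trans_lt hbb⟩, mem_univ _⟩
    have hat : ContDiffAt ℝ n (uncurry ψ) p :=
      (hψs.of_le (mod_cast le_top)).contDiffAt
        (mem_of_superset ((isOpen_Ioo.prod isOpen_univ).mem_nhds hpo)
          (Set.prod_mono Ioo_subset_Ico_self Subset.rfl))
    rw [iteratedFDerivWithin_eq_iteratedFDeriv hSU hat hp]
    exact hC p hpo
  intro p hp
  rcases lt_or_eq_of_le hp.1.1 with hpa | hpa
  · exact hint p hp hpa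
  -- the initial face, by continuity along `k ↦ (a + (b' - a)/(k + 2), x)`
  have hseq : Tendsto (fun k : ℕ => ((a + (b' - a) / ((k : ℝ) + 2), p.2) : ℝ × E)) atTop (𝓝 p) := by
    have h1 : Tendsto (fun k : ℕ => a + (b' - a) / ((k : ℝ) + 2)) atTop (𝓝 (a + 0)) := by
      refine tendsto_const_nhds.add ?_
      refine Tendsto.div_atTop tendsto_const_nhds ?_
      exact tendsto_atTop_add_const_right _ 2 tendsto_natCast_atTop_atTop
    rw [add_zero] at h1
    have h2 : Tendsto (fun k : ℕ => ((a + (b' - a) / ((k : ℝ) + 2), p.2) : ℝ × E)) atTop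
        (𝓝 (a, p.2)) := h1.prodMk_nhds tendsto_const_nhds
    rwa [show ((a, p.2) : ℝ × E) = p from by rw [hpa]] at h2
  have hmem : ∀ k : ℕ, ((a + (b' - a) / ((k : ℝ) + 2), p.2) : ℝ × E) ∈ S := fun k => by
    refine ⟨⟨?_, ?_⟩, mem_univ _⟩
    · have : 0 ≤ (b' - a) / ((k : ℝ) + 2) := by positivity
      linarith
    · have h2 : (b' - a) / ((k : ℝ) + 2) ≤ b' - a :=
        div_le_self (by linarith) (by linarith [(Nat.cast_nonneg' k : (0 : ℝ) ≤ k)])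
      linarith
  have hlim : Tendsto (fun k : ℕ => iteratedFDerivWithin ℝ n (uncurry ψ) S
      ((a + (b' - a) / ((k : ℝ) + 2), p.2) : ℝ × E)) atTop (𝓝 (iteratedFDerivWithin ℝ n (uncurry ψ) S p)) :=
    ((hcont p hp).tendsto.comp (tendsto_nhdsWithin_iff.2 ⟨hseq, Eventually.of_forall hmem⟩))
  refine le_of_tendsto ((continuous_norm.tendsto _).comp hlim) (Eventually.of_forall fun k => ?_)
  exact hint _ (hmem k) (by have : 0 < (b' - a) / ((k : ℝ) + 2) := by positivity
                            show a < a + (b' - a) / ((k : ℝ) + 2); linarith)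

/-- Anchor (registered sub-stub of stub W2): `laplacian_eq_sum_fderiv_fderiv` on `ℝ³`
(closed form, for the record). -/
theorem w2aux_laplacianTrace : ∀ (f : EuclideanSpace ℝ (Fin 3) → ℝ) (x : EuclideanSpace ℝ (Fin 3)),
    (Δ f) x = ∑ i, fderiv ℝ (fderiv ℝ f) x (stdOrthonormalBasis ℝ (EuclideanSpace ℝ (Fin 3)) i)
      (stdOrthonormalBasis ℝ (EuclideanSpace ℝ (Fin 3)) i) :=
  fun f x => laplacian_eq_sum_fderiv_fderiv f x

end Solution

end Summit.NavierStokesRegularity.NavierStokesRegularity.Theorems.SelfMixingDichotomy.MixingPayoffBirth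

end
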